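import Mathlib
import Summits.Ventures.PercRepro2.Defs
import Summits.Ventures.PercRepro2.Harris
import Summits.Ventures.PercRepro2.CoinDefs
import Summits.Ventures.PercRepro2.CoinInduced

/-!
# Row 2′DARC is invariant under SUBDIVIDING an arc by a sure arc (blind cell PercRepro2,
night-2 g15; proofs/NIGHT2-DARC.md §52)

Let `S` be a set of single-arc coins of `D`, `arcs e = {(src e, tgt e)}` for `e ∈ S`.  The
SUBDIVIDED system `D_S` lives on the vertices `V ⊕ E` and the coins `E ⊕ E`: the coin `e ∈ S`
now carries the arc `inl (src e) → inr e` into a new vertex `inr e`, the new SURE coin `inr e`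
carries `inr e → inl (tgt e)`, every other coin keeps its arcs (relabelled by `inl`), the new
coins `inr e`, `e ∉ S`, carry nothing (`subArcs`, `subPr`).  Opening every new coin embeds the
configurations (`extC ω = Sum.elim ω true`), and

* the weight of a configuration of `D_S` with a new coin closed is `0` (the coin is sure), so
  every expectation of `D_S` is the expectation of `D` of the pulled-back function
  (`sum_sub`, `expect_sub`, `prob_sub`, `massE_sub`);
* on the extended configurations reachability between old vertices is unchanged — a path
  through `inl (src e) → inr e → inl (tgt e)` is the old arc `src e → tgt e` and conversely
  (`reach_sub`, `reach_sub_iff`), so the forward / backward / avoidance / gate events and the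
  markers pull back to the old ones (`gateEvent_sub_preimage`, `marker_sub`);
* hence the cleared gate functional is equal (`phiC_gate_sub`) and **row 2′DARC holds in `D_S`
  for the image data iff it holds in `D` (`darc_sub_iff`)**.

Together with §50's transport this makes every sure-coin theorem of the OR-tail theory an
arbitrary-coin theorem: subdividing the entry coins `r → a` turns them into sure entries
`inr (c r) → a` of an extended core (`CoinKSureSubOrTail`).
-/

namespace Summit.Ventures.PercRepro2.Coin

open Classical

section SubdivideDefs

variable {V : Type*} {E : Type*} [DecidableEq E]

/-- The subdivided arc map: the coin `e ∈ S` carries `inl (src e) → inr e`, the new sure coin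
`inr e` carries `inr e → inl (tgt e)`; other old coins keep their arcs, other new coins are
empty. -/
def subArcs (arcs : E → Finset (V × V)) (S : Finset E) (src tgt : E → V) :
    E ⊕ E → Finset ((V ⊕ E) × (V ⊕ E))
  | Sum.inl e => if e ∈ S then {(Sum.inl (src e), Sum.inr e)}
      else (arcs e).map (Function.Embedding.inl.prodMap Function.Embedding.inl)
  | Sum.inr e => if e ∈ S then {(Sum.inr e, Sum.inl (tgt e))} else ∅

/-- The subdivided probability vector: the old coins keep their probabilities, the new coins
are sure. -/
def subPr {R : Type*} [One R] (pr : E → R) : E ⊕ E → R := Sum.elim pr (fun _ => 1)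

/-- A configuration extended by opening every new coin. -/
def extC (ω : Config E) : Config (E ⊕ E) := Sum.elim ω (fun _ => true)

omit [DecidableEq E] in
/-- `extC` is injective. -/
lemma extC_injective : Function.Injective (extC : Config E → Config (E ⊕ E)) := by
  intro ω₁ ω₂ h
  funext e
  have := congrFun h (Sum.inl e)
  simpa [extC] using this

variable {arcs : E → Finset (V × V)} {S : Finset E} {src tgt : E → V}

/-- An open arc out of an old vertex: either an old open arc, or the first half of a subdivided
coin. -/
lemma openArc_sub_inl {ω : Config E} {x : V} {z : V ⊕ E}
    (h : OpenArc (subArcs arcs S src tgt) (extC ω) (Sum.inl x) z) :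
    (∃ y, z = Sum.inl y ∧ OpenArc arcs ω x y) ∨
      (∃ e ∈ S, z = Sum.inr e ∧ x = src e ∧ ω e = true) := by
  obtain ⟨e', he', hxz⟩ := h
  cases e' with
  | inl e =>
    simp only [subArcs] at hxz
    by_cases heS : e ∈ S
    · rw [if_pos heS, Finset.mem_singleton, Prod.mk.injEq] at hxz
      obtain ⟨hx, hz⟩ := hxz
      exact Or.inr ⟨e, heS, hz, Sum.inl_injective hx, he'⟩
    · rw [if_neg heS] at hxz
      obtain ⟨⟨x₁, y₁⟩, hxy, hf⟩ := Finset.mem_map.1 hxz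
      have hf' : (Sum.inl x₁, Sum.inl y₁) = (Sum.inl x, z) := hf
      simp only [Prod.mk.injEq] at hf'
      obtain ⟨hx, hz⟩ := hf'
      rw [Sum.inl_injective hx] at hxy
      exact Or.inl ⟨y₁, hz.symm, e, he', hxy⟩
  | inr e =>
    simp only [subArcs] at hxz
    by_cases heS : e ∈ S
    · rw [if_pos heS, Finset.mem_singleton, Prod.mk.injEq] at hxz
      exact absurd hxz.1 Sum.inl_ne_inr
    · rw [if_neg heS] at hxz
      exact absurd hxz (Finset.notMem_empty _)

/-- An open arc out of a new vertex is the second half of its subdivided coin. -/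
lemma openArc_sub_inr {ω : Config E} {e : E} {z : V ⊕ E}
    (h : OpenArc (subArcs arcs S src tgt) (extC ω) (Sum.inr e) z) :
    e ∈ S ∧ z = Sum.inl (tgt e) := by
  obtain ⟨e', _, hz⟩ := h
  cases e' with
  | inl e₁ =>
    simp only [subArcs] at hz
    by_cases heS : e₁ ∈ S
    · rw [if_pos heS, Finset.mem_singleton, Prod.mk.injEq] at hz
      exact absurd hz.1 Sum.inr_ne_inl
    · rw [if_neg heS] at hz
      obtain ⟨⟨x₁, y₁⟩, _, hf⟩ := Finset.mem_map.1 hz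
      have hf' : (Sum.inl x₁, Sum.inl y₁) = (Sum.inr e, z) := hf
      simp only [Prod.mk.injEq] at hf'
      exact absurd hf'.1 Sum.inl_ne_inr
  | inr e₁ =>
    simp only [subArcs] at hz
    by_cases heS : e₁ ∈ S
    · rw [if_pos heS, Finset.mem_singleton, Prod.mk.injEq] at hz
      obtain ⟨he, hz⟩ := hz
      have he' := Sum.inr_injective he
      subst he'
      exact ⟨heS, hz⟩
    · rw [if_neg heS] at hz
      exact absurd hz (Finset.notMem_empty _)

/-- **Reachability in the subdivided system** (on extended configurations): an old vertex
reaches an old vertex iff it did before, and it reaches the new vertex `inr e` iff it reaches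
`src e` with the coin `e` open. -/
theorem reach_sub (hS : ∀ e ∈ S, arcs e = {(src e, tgt e)}) {ω : Config E} {x : V} {z : V ⊕ E} :
    Reach (subArcs arcs S src tgt) (extC ω) (Sum.inl x) z ↔
      (∃ y, z = Sum.inl y ∧ Reach arcs ω x y) ∨
      (∃ e ∈ S, z = Sum.inr e ∧ Reach arcs ω x (src e) ∧ ω e = true) := by
  constructor
  · intro h
    induction h with
    | refl => exact Or.inl ⟨x, rfl, reach_refl arcs ω x⟩
    | tail _ hstep ih =>
      rcases ih with ⟨y, rfl, hxy⟩ | ⟨e, heS, rfl, hxe, he⟩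
      · rcases openArc_sub_inl hstep with ⟨y₂, rfl, hyy₂⟩ | ⟨e, heS, rfl, rfl, he⟩
        · exact Or.inl ⟨y₂, rfl, reach_trans hxy (reach_of_openArc hyy₂)⟩
        · exact Or.inr ⟨e, heS, rfl, hxy, he⟩
      · obtain ⟨_, rfl⟩ := openArc_sub_inr hstep
        refine Or.inl ⟨tgt e, rfl, reach_trans hxe (reach_of_openArc ⟨e, he, ?_⟩)⟩
        rw [hS e heS]
        exact Finset.mem_singleton_self _
  · have lift : ∀ {p q : V}, Reach arcs ω p q →
        Reach (subArcs arcs S src tgt) (extC ω) (Sum.inl p) (Sum.inl q) := by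
      intro p q h
      induction h with
      | refl => exact reach_refl _ _ _
      | tail _ hstep ih =>
        obtain ⟨e, he, hxy⟩ := hstep
        by_cases heS : e ∈ S
        · rw [hS e heS, Finset.mem_singleton, Prod.mk.injEq] at hxy
          obtain ⟨rfl, rfl⟩ := hxy
          have h1 : Reach (subArcs arcs S src tgt) (extC ω) (Sum.inl (src e)) (Sum.inr e) :=
            reach_of_openArc ⟨Sum.inl e, he, by simp only [subArcs, if_pos heS, Finset.mem_singleton]⟩
          have h2 : Reach (subArcs arcs S src tgt) (extC ω) (Sum.inr e) (Sum.inl (tgt e)) :=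
            reach_of_openArc ⟨Sum.inr e, rfl, by simp only [subArcs, if_pos heS, Finset.mem_singleton]⟩
          exact reach_trans ih (reach_trans h1 h2)
        · refine reach_trans ih (reach_of_openArc ⟨Sum.inl e, he, ?_⟩)
          simp only [subArcs, if_neg heS]
          exact Finset.mem_map.2 ⟨_, hxy, rfl⟩
    rintro (⟨y, rfl, h⟩ | ⟨e, heS, rfl, hxe, he⟩)
    · exact lift h
    · refine reach_trans (lift hxe) (reach_of_openArc ⟨Sum.inl e, he, ?_⟩)
      simp only [subArcs, if_pos heS, Finset.mem_singleton]

/-- Reachability between old vertices is unchanged. -/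
theorem reach_sub_iff (hS : ∀ e ∈ S, arcs e = {(src e, tgt e)}) {ω : Config E} {x y : V} :
    Reach (subArcs arcs S src tgt) (extC ω) (Sum.inl x) (Sum.inl y) ↔ Reach arcs ω x y := by
  rw [reach_sub hS]
  constructor
  · rintro (⟨y', hy, h⟩ | ⟨e, _, he, _⟩)
    · rw [Sum.inl_injective hy]
      exact h
    · exact absurd he Sum.inl_ne_inr
  · intro h
    exact Or.inl ⟨y, rfl, h⟩

/-- The forward-cluster event pulls back. -/
lemma fwdEvent_sub_preimage (hS : ∀ e ∈ S, arcs e = {(src e, tgt e)}) (s v : V) :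
    extC ⁻¹' fwdEvent (subArcs arcs S src tgt) (Sum.inl s) (Sum.inl v) = fwdEvent arcs s v := by
  ext ω
  simp only [Set.mem_preimage, fwdEvent, Set.mem_setOf_eq, reach_sub_iff hS]

/-- The backward-cluster event pulls back. -/
lemma bwdEvent_sub_preimage (hS : ∀ e ∈ S, arcs e = {(src e, tgt e)}) (v : V) (T : Finset V) :
    extC ⁻¹' bwdEvent (subArcs arcs S src tgt) (Sum.inl v) (T.map Function.Embedding.inl) =
      bwdEvent arcs v T := by
  ext ω
  simp only [Set.mem_preimage, bwdEvent, Set.mem_setOf_eq]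
  constructor
  · rintro ⟨t', ht', h⟩
    obtain ⟨t, ht, rfl⟩ := Finset.mem_map.1 ht'
    exact ⟨t, ht, (reach_sub_iff hS).1 h⟩
  · rintro ⟨t, ht, h⟩
    exact ⟨Sum.inl t, Finset.mem_map_of_mem _ ht, (reach_sub_iff hS).2 h⟩

/-- The avoidance event pulls back. -/
lemma avoidEvent_sub_preimage (hS : ∀ e ∈ S, arcs e = {(src e, tgt e)}) (s : V) (T : Finset V) :
    extC ⁻¹' avoidEvent (subArcs arcs S src tgt) (Sum.inl s) (T.map Function.Embedding.inl) =
      avoidEvent arcs s T := by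
  ext ω
  simp only [Set.mem_preimage, avoidEvent, Set.mem_setOf_eq]
  constructor
  · intro h t ht hr
    exact h (Sum.inl t) (Finset.mem_map_of_mem _ ht) ((reach_sub_iff hS).2 hr)
  · intro h t' ht' hr
    obtain ⟨t, ht, rfl⟩ := Finset.mem_map.1 ht'
    exact h t ht ((reach_sub_iff hS).1 hr)

/-- The gate event pulls back. -/
lemma gateEvent_sub_preimage (hS : ∀ e ∈ S, arcs e = {(src e, tgt e)}) (s : V) (T : Finset V)
    (u w : V) :
    extC ⁻¹' gateEvent (subArcs arcs S src tgt) (Sum.inl s) (T.map Function.Embedding.inl)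
        (Sum.inl u) (Sum.inl w) = gateEvent arcs s T u w := by
  rw [gateEvent_eq_union, gateEvent_eq_union, Set.preimage_inter, Set.preimage_union,
    Set.preimage_compl, Set.preimage_compl, avoidEvent_sub_preimage hS, fwdEvent_sub_preimage hS,
    bwdEvent_sub_preimage hS]

variable {R : Type*} [CommRing R]

/-- The marker pulls back (pointwise). -/
lemma marker_sub_apply (hS : ∀ e ∈ S, arcs e = {(src e, tgt e)}) (s a : V) (ω : Config E) :
    marker (R := R) (subArcs arcs S src tgt) (Sum.inl s) (Sum.inl a) (extC ω) =
      marker arcs s a ω := by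
  unfold marker
  by_cases hr : Reach arcs ω s a
  · rw [if_pos hr, if_pos ((reach_sub_iff hS).2 hr)]
  · rw [if_neg hr, if_neg (fun h => hr ((reach_sub_iff hS).1 h))]

/-- The marker pulls back. -/
lemma marker_sub (hS : ∀ e ∈ S, arcs e = {(src e, tgt e)}) (s a : V) :
    (fun ω => marker (R := R) (subArcs arcs S src tgt) (Sum.inl s) (Sum.inl a) (extC ω)) =
      marker arcs s a := by
  funext ω
  exact marker_sub_apply hS s a ω

end SubdivideDefs

section SubdivideSums

variable {E : Type*} [Fintype E] [DecidableEq E] {R : Type*} [CommRing R]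

omit [DecidableEq E] in
/-- The weight of an extended configuration is the old weight (the new coins are sure and open). -/
lemma weight_subPr_extC (pr : E → R) (ω : Config E) :
    weight (subPr pr) (extC ω) = weight pr ω := by
  unfold weight
  rw [Fintype.prod_sum_type]
  simp only [subPr, extC, Sum.elim_inl, Sum.elim_inr, edgeFactor_true, Finset.prod_const_one,
    mul_one]

omit [DecidableEq E] in
/-- A configuration with a new coin closed has weight `0`. -/
lemma weight_subPr_eq_zero (pr : E → R) {ω' : Config (E ⊕ E)} {e : E}
    (h : ω' (Sum.inr e) = false) : weight (subPr pr) ω' = 0 := by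
  unfold weight
  apply Finset.prod_eq_zero (Finset.mem_univ (Sum.inr e))
  simp [subPr, h]

/-- **Summing over the subdivided configurations**: a function vanishing whenever a new coin is
closed sums over the extended configurations only. -/
lemma sum_sub (h : Config (E ⊕ E) → R) (hv : ∀ ω', (∃ e, ω' (Sum.inr e) = false) → h ω' = 0) :
    ∑ ω', h ω' = ∑ ω, h (extC ω) := by
  have hinj : ∀ ω₁ ∈ (Finset.univ : Finset (Config E)), ∀ ω₂ ∈ (Finset.univ : Finset (Config E)),
      extC ω₁ = extC ω₂ → ω₁ = ω₂ := fun ω₁ _ ω₂ _ heq => extC_injective heq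
  rw [← Finset.sum_image hinj]
  symm
  apply Finset.sum_subset (Finset.subset_univ _)
  intro ω' _ hnot
  apply hv
  by_contra hcon
  apply hnot
  rw [Finset.mem_image]
  refine ⟨fun e => ω' (Sum.inl e), Finset.mem_univ _, ?_⟩
  funext e'
  cases e' with
  | inl e => rfl
  | inr e =>
    simp only [extC, Sum.elim_inr]
    cases hb : ω' (Sum.inr e) with
    | false => exact absurd ⟨e, hb⟩ hcon
    | true => rfl

/-- Expectations in the subdivided system are expectations of the pulled-back function. -/
lemma expect_sub (pr : E → R) (f : Config (E ⊕ E) → R) :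
    expect (subPr pr) f = expect pr (fun ω => f (extC ω)) := by
  unfold expect
  rw [sum_sub (fun ω' => weight (subPr pr) ω' * f ω')
    (fun ω' ⟨e, he⟩ => by rw [weight_subPr_eq_zero pr he, zero_mul])]
  simp only [weight_subPr_extC]

/-- Probabilities in the subdivided system are probabilities of the pulled-back event. -/
lemma prob_sub (pr : E → R) (A : Set (Config (E ⊕ E))) :
    prob (subPr pr) A = prob pr (extC ⁻¹' A) := by
  unfold prob
  rw [sum_sub (fun ω' => A.indicator (weight (subPr pr)) ω') ?_]
  · refine Finset.sum_congr rfl fun ω _ => ?_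
    simp only [Set.indicator, Set.mem_preimage, weight_subPr_extC]
  · rintro ω' ⟨e, he⟩
    simp only [Set.indicator, weight_subPr_eq_zero pr he, ite_self]

/-- Restricted expectations in the subdivided system pull back. -/
lemma massE_sub (pr : E → R) (f : Config (E ⊕ E) → R) (D : Set (Config (E ⊕ E))) :
    massE (subPr pr) f D = massE pr (fun ω => f (extC ω)) (extC ⁻¹' D) := by
  unfold massE
  rw [expect_sub]
  rfl

omit [Fintype E] [DecidableEq E] in
/-- The subdivided probability vector is a probability vector. -/
lemma isProbVec_subPr [LinearOrder R] [IsStrictOrderedRing R] {pr : E → R} (hp : IsProbVec pr) :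
    IsProbVec (subPr pr) where
  nonneg := by
    intro e
    cases e with
    | inl e => exact hp.nonneg e
    | inr e => exact zero_le_one
  le_one := by
    intro e
    cases e with
    | inl e => exact hp.le_one e
    | inr e => exact le_refl _

end SubdivideSums

section SubdivideDarc

variable {V : Type*} {E : Type*} [Fintype E] [DecidableEq E] {R : Type*} [CommRing R]
  {arcs : E → Finset (V × V)} {S : Finset E} {src tgt : E → V}

/-- The cleared gate functional of the subdivided system is the old one. -/
theorem phiC_gate_sub (hS : ∀ e ∈ S, arcs e = {(src e, tgt e)}) (pr : E → R) (s : V)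
    (T : Finset V) (a b u w : V) :
    phiC (subPr pr) (subArcs arcs S src tgt) (Sum.inl s) (T.map Function.Embedding.inl)
        (Sum.inl a) (Sum.inl b)
        (gateEvent (subArcs arcs S src tgt) (Sum.inl s) (T.map Function.Embedding.inl)
          (Sum.inl u) (Sum.inl w)) =
      phiC pr arcs s T a b (gateEvent arcs s T u w) := by
  simp only [phiC]
  rw [prob_sub, prob_sub, massE_sub, massE_sub, massE_sub, massE_sub, massE_sub,
    gateEvent_sub_preimage hS, avoidEvent_sub_preimage hS]
  have hab : (fun ω => marker (R := R) (subArcs arcs S src tgt) (Sum.inl s) (Sum.inl a) (extC ω) *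
      marker (R := R) (subArcs arcs S src tgt) (Sum.inl s) (Sum.inl b) (extC ω)) =
      fun ω => marker (R := R) arcs s a ω * marker (R := R) arcs s b ω := by
    funext ω
    rw [marker_sub_apply hS, marker_sub_apply hS]
  rw [hab, marker_sub hS, marker_sub hS]

/-- **Row 2′DARC is invariant under subdividing single-arc coins by sure arcs.** -/
theorem darc_sub_iff [LinearOrder R] (hS : ∀ e ∈ S, arcs e = {(src e, tgt e)}) (pr : E → R)
    (s : V) (T : Finset V) (a b u w : V) :
    DARC (subPr pr) (subArcs arcs S src tgt) (Sum.inl s) (T.map Function.Embedding.inl)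
        (Sum.inl a) (Sum.inl b) (Sum.inl u) (Sum.inl w) ↔
      DARC pr arcs s T a b u w := by
  unfold DARC
  rw [phiC_gate_sub hS]

omit [Fintype E] in
/-- `SameEnds` is preserved by subdivision. -/
lemma sameEnds_sub (hS' : SameEnds arcs) : SameEnds (subArcs arcs S src tgt) := by
  intro e' xy hxy x'y' hx'y'
  cases e' with
  | inl e =>
    simp only [subArcs] at hxy hx'y'
    by_cases heS : e ∈ S
    · rw [if_pos heS, Finset.mem_singleton] at hxy hx'y'
      rw [hxy, hx'y']
      exact ⟨Or.inl rfl, Or.inr rfl⟩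
    · rw [if_neg heS] at hxy hx'y'
      obtain ⟨⟨x, y⟩, hxy₀, hf⟩ := Finset.mem_map.1 hxy
      obtain ⟨⟨x', y'⟩, hx'y'₀, hf'⟩ := Finset.mem_map.1 hx'y'
      have hf1 : (Sum.inl x, Sum.inl y) = xy := hf
      have hf2 : (Sum.inl x', Sum.inl y') = x'y' := hf'
      rw [← hf1, ← hf2]
      obtain ⟨h1, h2⟩ := hS' e (x, y) hxy₀ (x', y') hx'y'₀
      have h1' : x' = x ∨ x' = y := h1
      have h2' : y' = x ∨ y' = y := h2
      constructor
      · rcases h1' with h | h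
        · exact Or.inl (by rw [h])
        · exact Or.inr (by rw [h])
      · rcases h2' with h | h
        · exact Or.inl (by rw [h])
        · exact Or.inr (by rw [h])
  | inr e =>
    simp only [subArcs] at hxy hx'y'
    by_cases heS : e ∈ S
    · rw [if_pos heS, Finset.mem_singleton] at hxy hx'y'
      rw [hxy, hx'y']
      exact ⟨Or.inl rfl, Or.inr rfl⟩
    · rw [if_neg heS] at hxy
      exact absurd hxy (Finset.notMem_empty _)

end SubdivideDarc

end Summit.Ventures.PercRepro2.Coin
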